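import Literature.Combinatorics.Optimization.PatternMatrixRankUpperBounds
import Literature.Barriers.PneNP.ExtendedFormulationYannakakisConverse
import Literature.Computability.Complexity.DisjointnessRandomizedCommunication
import HarnessLib

/-!
# Randomized protocols computing a matrix in expectation ⇔ nonnegative factorizations
# (Faenza–Fiorini–Grappe–Tiwary) — PROVED

Source: Y. Faenza, S. Fiorini, R. Grappe, H. R. Tiwary, *Extended formulations, nonnegative
factorizations, and randomized communication protocols*, Math. Program. 153 (2015) 75–94; ISCO 2012,
LNCS 7422; arXiv:1105.4127 [FaenzaFioriniGrappeTiwary2015] (open; theorem numbers below are those of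
the ISCO/arXiv version, §§3–5).
Verbatim (§3): "A randomized protocol with private random bits (or shortly, a randomized protocol) is
a rooted binary tree with some extra information attached to the nodes. Each internal node has a type,
which is either `X` or `Y`. To each node `v` of type `X` is attached a function `p_v : X → [0,1]`; to
each node `v` of type `Y` is attached a function `q_v : Y → [0,1]`; and to each leaf `v` is attached a
non-negative number `λ_v ∈ ℝ_+`, called the value of that leaf. … An execution of the protocol on input
`(x,y)` is a random root-to-leaf path that starts at the root and descends to the left child of an
internal node `v` with probability `p_v(x)` if `v` is of type `X` and `q_v(y)` if `v` is of type `Y`, and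
to the right child of `v` with the complementary probability … The value of the execution is the value
of leaf attained by the execution. … We say that the protocol computes a function `f : X × Y → Z` in
expectation if the expectation of this random variable on each `(x,y) ∈ X × Y` is precisely `f(x,y)`.
The complexity of a protocol is the height of the corresponding tree." (§4): "**Theorem 2.** If there
exists a randomized protocol of complexity `c` computing a matrix `M ∈ ℝ^{X×Y}_+` in expectation, then
the non-negative rank of `M` is at most `2^c`. *Proof.* Each node `v` of the protocol has a
corresponding traversal probability matrix `P_v` … We claim that `P_v` is always a rank one matrix. …
`P_u = p' qᵀ` where `p'(x) = p(x)p_v(x)` … in case `u` is the left child of `v`, and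
`p'(x) = p(x)(1−p_v(x))` … `M = Σ_{v ∈ L} λ_v P_v`. Since the claim holds, each term in this last sum is
a non-negative rank one matrix." (§5): "**Theorem 5.** If … `M ∈ ℝ^{m×n}_+` has a rank `r` non-negative
factorization, then there exists a randomized protocol computing `M` in expectation, whose complexity
is at most `lg r + O(1)`. *Proof.* Let `A ∈ ℝ_+^{m×r}` and `B ∈ ℝ_+^{r×n}` be non-negative matrices such
that `M = AB`. Let `Δ` denote the maximum row sum of `A`. Thus, `M = (A/Δ)(ΔB)`. Let `Â` denote the
`m × (r+1)` matrix obtained from `A/Δ` by appending a column whose entries are chosen so that each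
row-sum of `Â` is precisely `1`. … Let `B̂` denote the `(r+1) × n` matrix obtained from `ΔB` by
appending a zero row. Notice that `M = ÂB̂`. … Alice selects a column index `k ∈ [r+1]` according to
the probabilities found in row `i` of matrix `Â`, sends this index to Bob, and Bob outputs the entry
of `B̂` in row `k` and column `j`. … The tree is balanced. All of its internal nodes are assigned to
Alice, except those in the last layer which are assigned to Bob. … The node `v = v(k)` has two children
which are both leaves: the left leaf has value `max{B̂(k,ℓ) : ℓ ∈ [n]}` and the right leaf `0`. The
transition probability `q_v(j)` is defined in such a way that the expected value output is correct".

## What is proved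

* `RandProtocol X Y` — the printed tree model (Alice nodes `p_v : X → ℝ`, Bob nodes `q_v : Y → ℝ`,
  leaf values), `RandProtocol.WF` (probabilities in `[0,1]`, values `≥ 0`), `RandProtocol.expect`
  (expected value of an execution), `depth` (= complexity), `leafCount`;
* `RandProtocol.hasNonnegFactorization_expect` — the matrix computed in expectation by a well-formed
  protocol has a nonnegative factorization of size `leafCount ≤ 2^{depth}` (tree vocabulary
  `HasNonnegFactorization`); `FaenzaFioriniGrappeTiwary2015_thm2` — **Theorem 2**;
* `RandProtocol.announce` — Alice announces a bit string sampled with given (unnormalised, private)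
  weights by a balanced tree of Alice nodes with the conditional probabilities
  (`announce_expect`: `(Σ_v w_v(x))·𝔼 = Σ_v w_v(x)·𝔼[cont v]`); `RandProtocol.bobOut` — Bob outputs a
  nonnegative number `g(y)` in expectation with one node and two leaves;
  `FaenzaFioriniGrappeTiwary2015_thm5` — **Theorem 5**: a size-`r` nonnegative factorization yields a
  well-formed protocol of depth `≤ ⌊log₂(r+1)⌋ + 2` computing `M` in expectation (we normalise by the
  total mass `Δ = Σ_x Σ_l A(x,l)` and use `Σ_y B̂(k,y)` in place of the printed maxima — any upper bounds
  do).
* `FaenzaFioriniGrappeTiwary2015_ef_of_protocol` — the paper's headline consequence (its §1 / Thm. 2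
  with Yannakakis' factorization theorem, the tree's `hasEFOfSize_of_complete_nonneg_factorization`):
  a well-formed randomized protocol of complexity `c` computing the slack matrix of a complete
  inequality description of `P = conv(V)` in expectation yields an extended formulation of `P` of size
  `2^c` ("every extension of a polytope `P` corresponds to a randomized protocol computing its slack
  matrix `S(P)` in expectation and vice-versa", §6).
* `DetProtocol.toRand` — deterministic protocols (the tree's `DetProtocol`, outputs read through a
  valuation) ARE randomized protocols with `0/1` transition probabilities (`toRand_expect`,
  `toRand_depth`, `toRand_WF`: §3.1 "`p_v : X → {0,1}`"); `RandProtocol.rowSplit` and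
  `FaenzaFioriniGrappeTiwary2015_lemma3` — **Lemma 3**: protocols for the two parts of a row partition
  combine at the cost of one bit.
-/

noncomputable section

namespace Literature.Computability.Complexity

open Finset
open Literature.Combinatorics.Optimization (HasNonnegFactorization)

/-- **A randomized protocol with private random bits** (Faenza–Fiorini–Grappe–Tiwary): a binary
tree whose inner nodes belong to Alice (transition probability `p_v(x)` of descending to the LEFT
child) or to Bob (`q_v(y)`), and whose leaves carry real values.
[cite: FaenzaFioriniGrappeTiwary2015, §3 (definition of randomized protocols)] -/
inductive RandProtocol (X Y : Type*)
  | leaf : ℝ → RandProtocol X Y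
  | alice : (X → ℝ) → RandProtocol X Y → RandProtocol X Y → RandProtocol X Y
  | bob : (Y → ℝ) → RandProtocol X Y → RandProtocol X Y → RandProtocol X Y

namespace RandProtocol

variable {X Y : Type*}

/-- Well-formedness: transition probabilities in `[0,1]`, leaf values `≥ 0`.
[cite: FaenzaFioriniGrappeTiwary2015, §3 ("`p_v : X → [0,1]` … a non-negative number `λ_v`")] -/
def WF : RandProtocol X Y → Prop
  | leaf v => 0 ≤ v
  | alice p L R => (∀ x, 0 ≤ p x ∧ p x ≤ 1) ∧ WF L ∧ WF R
  | bob q L R => (∀ y, 0 ≤ q y ∧ q y ≤ 1) ∧ WF L ∧ WF R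

/-- The expected value of an execution on input `(x, y)`.
[cite: FaenzaFioriniGrappeTiwary2015, §3 ("computes … in expectation")] -/
def expect : RandProtocol X Y → X → Y → ℝ
  | leaf v, _, _ => v
  | alice p L R, x, y => p x * expect L x y + (1 - p x) * expect R x y
  | bob q L R, x, y => q y * expect L x y + (1 - q y) * expect R x y

/-- The complexity of a protocol: the height of the tree. [cite: FaenzaFioriniGrappeTiwary2015, §3] -/
def depth : RandProtocol X Y → ℕ
  | leaf _ => 0
  | alice _ L R => max (depth L) (depth R) + 1
  | bob _ L R => max (depth L) (depth R) + 1

/-- The number of leaves. [cite: FaenzaFioriniGrappeTiwary2015, §4 (proof of Thm. 2: "let `L` be the set of all leaves")] -/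
def leafCount : RandProtocol X Y → ℕ
  | leaf _ => 1
  | alice _ L R => leafCount L + leafCount R
  | bob _ L R => leafCount L + leafCount R

/-- A tree of height `c` has at most `2^c` leaves. [cite: FaenzaFioriniGrappeTiwary2015, §4 (Thm. 2: "at most `2^c`")] -/
theorem leafCount_le_two_pow_depth : ∀ P : RandProtocol X Y, P.leafCount ≤ 2 ^ P.depth
  | leaf _ => by simp [leafCount, depth]
  | alice _ L R => by
      have hL := leafCount_le_two_pow_depth L
      have hR := leafCount_le_two_pow_depth R
      have h1 : 2 ^ L.depth ≤ 2 ^ max L.depth R.depth := Nat.pow_le_pow_right (by norm_num) (le_max_left _ _)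
      have h2 : 2 ^ R.depth ≤ 2 ^ max L.depth R.depth := Nat.pow_le_pow_right (by norm_num) (le_max_right _ _)
      simp only [leafCount, depth, pow_succ]
      omega
  | bob _ L R => by
      have hL := leafCount_le_two_pow_depth L
      have hR := leafCount_le_two_pow_depth R
      have h1 : 2 ^ L.depth ≤ 2 ^ max L.depth R.depth := Nat.pow_le_pow_right (by norm_num) (le_max_left _ _)
      have h2 : 2 ^ R.depth ≤ 2 ^ max L.depth R.depth := Nat.pow_le_pow_right (by norm_num) (le_max_right _ _)
      simp only [leafCount, depth, pow_succ]
      omega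

/-! ### Theorem 2: protocols give factorizations -/

/-- Scaling the rows of a nonnegative factorization by nonnegative weights. [cite:
FaenzaFioriniGrappeTiwary2015, §4 (proof of Thm. 2: "`p'(x) = p(x)p_v(x)`")] -/
theorem _root_.Literature.Combinatorics.Optimization.HasNonnegFactorization.rowScale {M : X → Y → ℝ}
    {r : ℕ} (h : HasNonnegFactorization M r) (w : X → ℝ) (hw : ∀ x, 0 ≤ w x) :
    HasNonnegFactorization (fun x y => w x * M x y) r := by
  obtain ⟨U, V, hU, hV, hM⟩ := h
  refine ⟨fun x l => w x * U x l, V, fun x l => mul_nonneg (hw x) (hU x l), hV, fun x y => ?_⟩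
  show w x * M x y = ∑ l, w x * U x l * V l y
  rw [hM x y, Finset.mul_sum]
  exact Finset.sum_congr rfl fun l _ => by ring

/-- **The traversal-probability argument of Theorem 2**: the function computed in expectation by a
well-formed randomized protocol has a nonnegative factorization with one term per leaf.
[cite: FaenzaFioriniGrappeTiwary2015, Thm. 2 (proof)] -/
theorem hasNonnegFactorization_expect :
    ∀ P : RandProtocol X Y, P.WF → HasNonnegFactorization P.expect P.leafCount
  | leaf v, h => ⟨fun _ _ => 1, fun _ _ => v, fun _ _ => zero_le_one, fun _ _ => h,
      fun x y => by simp [expect, leafCount]⟩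
  | alice p L R, h => by
      obtain ⟨hp, hL, hR⟩ := h
      have h1 := (hasNonnegFactorization_expect L hL).rowScale p (fun x => (hp x).1)
      have h2 := (hasNonnegFactorization_expect R hR).rowScale (fun x => 1 - p x)
        (fun x => sub_nonneg.2 (hp x).2)
      exact h1.add h2
  | bob q L R, h => by
      obtain ⟨hq, hL, hR⟩ := h
      obtain ⟨U, V, hU, hV, hfL⟩ := hasNonnegFactorization_expect L hL
      obtain ⟨U', V', hU', hV', hfR⟩ := hasNonnegFactorization_expect R hR
      have h1 : HasNonnegFactorization (fun x y => q y * L.expect x y) L.leafCount :=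
        ⟨U, fun l y => q y * V l y, hU, fun l y => mul_nonneg (hq y).1 (hV l y), fun x y => by
          show q y * L.expect x y = ∑ l, U x l * (q y * V l y)
          rw [hfL x y, Finset.mul_sum]
          exact Finset.sum_congr rfl fun l _ => by ring⟩
      have h2 : HasNonnegFactorization (fun x y => (1 - q y) * R.expect x y) R.leafCount :=
        ⟨U', fun l y => (1 - q y) * V' l y, hU', fun l y => mul_nonneg (sub_nonneg.2 (hq y).2) (hV' l y),
          fun x y => by
          show (1 - q y) * R.expect x y = ∑ l, U' x l * ((1 - q y) * V' l y)
          rw [hfR x y, Finset.mul_sum]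
          exact Finset.sum_congr rfl fun l _ => by ring⟩
      exact h1.add h2

end RandProtocol

/-- **Faenza–Fiorini–Grappe–Tiwary, Theorem 2.** If a (well-formed, private-coin) randomized protocol
of complexity `c` computes the matrix `M` in expectation, then the nonnegative rank of `M` is at most
`2^c`. [cite: FaenzaFioriniGrappeTiwary2015, Thm. 2] -/
theorem FaenzaFioriniGrappeTiwary2015_thm2 {X Y : Type*} (P : RandProtocol X Y) (hP : P.WF)
    (M : X → Y → ℝ) (hM : ∀ x y, P.expect x y = M x y) :
    HasNonnegFactorization M (2 ^ P.depth) := by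
  have h := (RandProtocol.hasNonnegFactorization_expect P hP).mono
    (RandProtocol.leafCount_le_two_pow_depth P)
  obtain ⟨U, V, hU, hV, hf⟩ := h
  exact ⟨U, V, hU, hV, fun x y => by rw [← hM x y]; exact hf x y⟩

/-! ### Theorem 5: factorizations give protocols -/

namespace RandProtocol

variable {X Y : Type*}

/-- Splitting a sum over `{0,1}^{b+1}` by the first bit. [folklore] -/
private theorem sum_cons_split {b : ℕ} (f : (Fin (b + 1) → Bool) → ℝ) :
    ∑ v, f v = ∑ v : Fin b → Bool, f (Fin.cons false v) + ∑ v : Fin b → Bool, f (Fin.cons true v) := by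
  rw [← Fintype.sum_equiv (Fin.consEquiv fun _ => Bool) (fun p => f (Fin.cons p.1 p.2)) f
    (fun p => rfl), Fintype.sum_prod_type, Fintype.sum_bool, add_comm]

/-- **Alice announces a bit string `v ∈ {0,1}^b`, sampled privately with (unnormalised) weights
`w_v(x)`**, by a balanced tree of `b` Alice nodes carrying the conditional probabilities of the next
bit; the protocol then continues with `cont v`. [cite: FaenzaFioriniGrappeTiwary2015, Thm. 5 (proof:
"Alice selects a column index `k` according to the probabilities found in row `i` of `Â`, sends this
index to Bob … The tree is balanced. All of its internal nodes are assigned to Alice")] -/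
def announce : (b : ℕ) → ((Fin b → Bool) → X → ℝ) → ((Fin b → Bool) → RandProtocol X Y) →
    RandProtocol X Y
  | 0, _, cont => cont fun i => i.elim0
  | b + 1, w, cont =>
      alice (fun x => (∑ v : Fin b → Bool, w (Fin.cons false v) x) / ∑ v, w v x)
        (announce b (fun v => w (Fin.cons false v)) fun v => cont (Fin.cons false v))
        (announce b (fun v => w (Fin.cons true v)) fun v => cont (Fin.cons true v))

/-- `announce` is well formed for nonnegative weights. [cite: FaenzaFioriniGrappeTiwary2015, Thm. 5 (proof)] -/
theorem announce_WF : ∀ (b : ℕ) (w : (Fin b → Bool) → X → ℝ) (cont : (Fin b → Bool) → RandProtocol X Y),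
    (∀ v x, 0 ≤ w v x) → (∀ v, (cont v).WF) → (announce b w cont).WF
  | 0, _, _, _, hc => hc _
  | b + 1, w, cont, hw, hc => by
      refine ⟨fun x => ⟨?_, ?_⟩, ?_, ?_⟩
      · exact div_nonneg (Finset.sum_nonneg fun v _ => hw _ x) (Finset.sum_nonneg fun v _ => hw _ x)
      · refine div_le_one_of_le₀ ?_ (Finset.sum_nonneg fun v _ => hw _ x)
        rw [sum_cons_split (fun v => w v x)]
        exact le_add_of_nonneg_right (Finset.sum_nonneg fun v _ => hw _ x)
      · exact announce_WF b _ _ (fun v x => hw _ x) (fun v => hc _)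
      · exact announce_WF b _ _ (fun v x => hw _ x) (fun v => hc _)

/-- Depth of `announce`: `b` plus the depth of the continuations.
[cite: FaenzaFioriniGrappeTiwary2015, Thm. 5 (proof: "the number of bits exchanged is `⌈lg(r+1)⌉`")] -/
theorem announce_depth_le : ∀ (b : ℕ) (w : (Fin b → Bool) → X → ℝ)
    (cont : (Fin b → Bool) → RandProtocol X Y) {d : ℕ}, (∀ v, (cont v).depth ≤ d) →
    (announce b w cont).depth ≤ b + d
  | 0, _, _, _, hc => by simpa [announce] using hc _
  | b + 1, w, cont, d, hc => by
      have h0 := announce_depth_le b (fun v => w (Fin.cons false v)) (fun v => cont (Fin.cons false v))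
        (d := d) (fun v => hc _)
      have h1 := announce_depth_le b (fun v => w (Fin.cons true v)) (fun v => cont (Fin.cons true v))
        (d := d) (fun v => hc _)
      simp only [announce, depth]
      omega

/-- **The announcement samples `v` with probability `w_v(x)/Σ_u w_u(x)`**:
`(Σ_v w_v(x))·𝔼[announce] = Σ_v w_v(x)·𝔼[cont v]` (telescoping of the conditional probabilities;
sub-trees of zero mass contribute zero on both sides). [cite: FaenzaFioriniGrappeTiwary2015, Thm. 5
(proof: "the expected value on input `(i,j)` is `Σ_k Â(i,k)B̂(k,j)`")] -/
theorem announce_expect : ∀ (b : ℕ) (w : (Fin b → Bool) → X → ℝ)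
    (cont : (Fin b → Bool) → RandProtocol X Y), (∀ v x, 0 ≤ w v x) → ∀ x y,
    (∑ v, w v x) * (announce b w cont).expect x y = ∑ v, w v x * (cont v).expect x y
  | 0, w, cont, _, x, y => by
      have hsub : ∀ v : Fin 0 → Bool, v = fun i => i.elim0 := fun v => funext fun i => i.elim0
      simp only [announce]
      rw [Finset.sum_mul]
      exact Finset.sum_congr rfl fun v _ => by rw [hsub v]
  | b + 1, w, cont, hw, x, y => by
      have ih₀ := announce_expect b (fun v => w (Fin.cons false v)) (fun v => cont (Fin.cons false v))
        (fun v x => hw _ x) x y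
      have ih₁ := announce_expect b (fun v => w (Fin.cons true v)) (fun v => cont (Fin.cons true v))
        (fun v x => hw _ x) x y
      rw [sum_cons_split (fun v => w v x * (cont v).expect x y), ← ih₀, ← ih₁,
        sum_cons_split (fun v => w v x)]
      simp only [announce, expect]
      rw [sum_cons_split (fun v => w v x)]
      set W₀ := ∑ v : Fin b → Bool, w (Fin.cons false v) x with hW₀
      set W₁ := ∑ v : Fin b → Bool, w (Fin.cons true v) x with hW₁
      have hW₀0 : 0 ≤ W₀ := Finset.sum_nonneg fun v _ => hw _ x
      have hW₁0 : 0 ≤ W₁ := Finset.sum_nonneg fun v _ => hw _ x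
      by_cases hW : W₀ + W₁ = 0
      · have h0 : W₀ = 0 := by linarith
        have h1 : W₁ = 0 := by linarith
        rw [h0, h1]
        ring
      · field_simp
        ring

/-- **Bob outputs `g(y) ≥ 0` in expectation** with one node and two leaves (values `c = Σ_y g(y)` —
any upper bound of `g` does, the text takes the maximum — and `0`; transition probability `g(y)/c`).
[cite: FaenzaFioriniGrappeTiwary2015, Thm. 5 (proof: "The node `v = v(k)` has two children which
are both leaves … `q_v(j)·max{…} = B̂(k,j)`")] -/
def bobOut [Fintype Y] (g : Y → ℝ) : RandProtocol X Y :=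
  bob (fun y => g y / ∑ y', g y') (leaf (∑ y', g y')) (leaf 0)

/-- `bobOut g` is well formed for `g ≥ 0`. [cite: FaenzaFioriniGrappeTiwary2015, Thm. 5 (proof)] -/
theorem bobOut_WF [Fintype Y] (g : Y → ℝ) (hg : ∀ y, 0 ≤ g y) : (bobOut g : RandProtocol X Y).WF := by
  refine ⟨fun y => ⟨div_nonneg (hg y) (Finset.sum_nonneg fun y _ => hg y), ?_⟩,
    Finset.sum_nonneg fun y _ => hg y, le_rfl⟩
  exact div_le_one_of_le₀ (Finset.single_le_sum (fun y _ => hg y) (mem_univ y))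
    (Finset.sum_nonneg fun y _ => hg y)

/-- `bobOut g` outputs `g(y)` in expectation. [cite: FaenzaFioriniGrappeTiwary2015, Thm. 5 (proof)] -/
theorem bobOut_expect [Fintype Y] (g : Y → ℝ) (hg : ∀ y, 0 ≤ g y) (x : X) (y : Y) :
    (bobOut g : RandProtocol X Y).expect x y = g y := by
  simp only [bobOut, expect, mul_zero, add_zero]
  by_cases h : ∑ y', g y' = 0
  · have : g y = 0 :=
      (Finset.sum_eq_zero_iff_of_nonneg (fun y _ => hg y)).1 h y (mem_univ y)
    rw [h, this]; ring
  · field_simp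

/-- `bobOut` has depth `1`. [cite: FaenzaFioriniGrappeTiwary2015, Thm. 5 (proof)] -/
theorem bobOut_depth [Fintype Y] (g : Y → ℝ) : (bobOut g : RandProtocol X Y).depth = 1 := by
  simp [bobOut, depth]

end RandProtocol

/-- An injective binary code of a finite type with at most `2^b` elements. [folklore] -/
private def code {γ : Type*} [Fintype γ] (b : ℕ) (h : Fintype.card γ ≤ 2 ^ b) : γ ↪ (Fin b → Bool) :=
  (Function.Embedding.nonempty_iff_card_le.2 (by simpa using h)).some

/-- **Faenza–Fiorini–Grappe–Tiwary, Theorem 5.** If the nonnegative matrix `M` has a nonnegative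
factorization of size `r`, then some well-formed randomized protocol of complexity
`≤ ⌊log₂(r+1)⌋ + 2 = lg r + O(1)` computes `M` in expectation: Alice samples `k ∈ [r+1]` from the row
`Â(x,·)` of the row-stochastic rescaling and announces it; Bob outputs `B̂(k,y)` in expectation.
[cite: FaenzaFioriniGrappeTiwary2015, Thm. 5] -/
theorem FaenzaFioriniGrappeTiwary2015_thm5 {X Y : Type*} [Fintype X] [Fintype Y] {M : X → Y → ℝ}
    {r : ℕ} (h : HasNonnegFactorization M r) :
    ∃ P : RandProtocol X Y, P.WF ∧ P.depth ≤ Nat.log 2 (r + 1) + 2 ∧ ∀ x y, P.expect x y = M x y := by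
  classical
  obtain ⟨U, V, hU, hV, hM⟩ := h
  -- total mass `Δ` (an upper bound on every row sum of `A`)
  set Δ : ℝ := ∑ x, ∑ l, U x l with hΔ
  have hΔ0 : 0 ≤ Δ := Finset.sum_nonneg fun x _ => Finset.sum_nonneg fun l _ => hU x l
  have hrow : ∀ x, ∑ l, U x l ≤ Δ := fun x =>
    Finset.single_le_sum (f := fun x => ∑ l, U x l) (fun x _ => Finset.sum_nonneg fun l _ => hU x l)
      (mem_univ x)
  by_cases hΔz : Δ = 0
  · -- `A = 0`, so `M = 0`: a single leaf
    have hU0 : ∀ x l, U x l = 0 := by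
      intro x l
      have hx : ∑ l, U x l = 0 := le_antisymm (by rw [← hΔz]; exact hrow x)
        (Finset.sum_nonneg fun l _ => hU x l)
      exact (Finset.sum_eq_zero_iff_of_nonneg (fun l _ => hU x l)).1 hx l (mem_univ l)
    refine ⟨RandProtocol.leaf 0, le_rfl, by simp [RandProtocol.depth], fun x y => ?_⟩
    rw [hM x y]
    simp [RandProtocol.expect, hU0]
  have hΔpos : 0 < Δ := lt_of_le_of_ne hΔ0 (Ne.symm hΔz)
  -- `Â : X × ([r] ⊕ {⊥}) → [0,1]` row-stochastic, `B̂` with a zero row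
  set Ah : X → Option (Fin r) → ℝ := fun x k =>
    match k with
    | some l => U x l / Δ
    | none => 1 - (∑ l, U x l) / Δ with hAh
  set Bh : Option (Fin r) → Y → ℝ := fun k y =>
    match k with
    | some l => Δ * V l y
    | none => 0 with hBh
  have hAh0 : ∀ x k, 0 ≤ Ah x k := by
    intro x k
    cases k with
    | some l => exact div_nonneg (hU x l) hΔ0
    | none =>
        show 0 ≤ 1 - (∑ l, U x l) / Δ
        rw [sub_nonneg, div_le_one hΔpos]
        exact hrow x
  have hBh0 : ∀ k y, 0 ≤ Bh k y := by
    intro k y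
    cases k with
    | some l => exact mul_nonneg hΔ0 (hV l y)
    | none => exact le_rfl
  have hAsum : ∀ x, ∑ k, Ah x k = 1 := by
    intro x
    rw [Fintype.sum_option]
    show (1 - (∑ l, U x l) / Δ) + ∑ l, U x l / Δ = 1
    rw [← Finset.sum_div]
    ring
  have hAB : ∀ x y, ∑ k, Ah x k * Bh k y = M x y := by
    intro x y
    rw [Fintype.sum_option, hM x y]
    show (1 - (∑ l, U x l) / Δ) * 0 + ∑ l, U x l / Δ * (Δ * V l y) = ∑ l, U x l * V l y
    rw [mul_zero, zero_add]
    exact Finset.sum_congr rfl fun l _ => by field_simp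
  -- the code of `[r+1]` on `b = ⌊log₂(r+1)⌋ + 1` bits
  set b := Nat.log 2 (r + 1) + 1 with hb
  have hcard : Fintype.card (Option (Fin r)) ≤ 2 ^ b := by
    rw [Fintype.card_option, Fintype.card_fin]
    exact (Nat.lt_pow_succ_log_self one_lt_two (r + 1)).le
  set cd := code b hcard with hcd
  -- weights and continuations on bit strings
  set w : (Fin b → Bool) → X → ℝ := fun v x => ∑ k, if cd k = v then Ah x k else 0 with hw
  set g : (Fin b → Bool) → Y → ℝ := fun v y => ∑ k, if cd k = v then Bh k y else 0 with hg
  have hw0 : ∀ v x, 0 ≤ w v x := fun v x =>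
    Finset.sum_nonneg fun k _ => by split_ifs <;> [exact hAh0 x k; exact le_rfl]
  have hg0 : ∀ v y, 0 ≤ g v y := fun v y =>
    Finset.sum_nonneg fun k _ => by split_ifs <;> [exact hBh0 k y; exact le_rfl]
  have hwsum : ∀ x, ∑ v, w v x = 1 := by
    intro x
    rw [← hAsum x]
    simp only [hw]
    rw [Finset.sum_comm]
    exact Finset.sum_congr rfl fun k _ => by
      rw [Finset.sum_ite_eq univ (cd k) (fun _ => Ah x k), if_pos (mem_univ _)]
  have hgcode : ∀ k y, g (cd k) y = Bh k y := by
    intro k y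
    simp only [hg]
    rw [Finset.sum_eq_single k]
    · rw [if_pos rfl]
    · intro k' _ hk'
      rw [if_neg (fun h => hk' (cd.injective h))]
    · intro h; exact absurd (mem_univ k) h
  refine ⟨RandProtocol.announce b w (fun v => RandProtocol.bobOut (g v)), ?_, ?_, fun x y => ?_⟩
  · exact RandProtocol.announce_WF b w _ hw0 (fun v => RandProtocol.bobOut_WF _ (hg0 v))
  · have := RandProtocol.announce_depth_le b w (fun v => RandProtocol.bobOut (g v)) (d := 1)
      (fun v => (RandProtocol.bobOut_depth (X := X) (g v)).le)
    omega
  · have h := RandProtocol.announce_expect b w (fun v => RandProtocol.bobOut (g v)) hw0 x y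
    rw [hwsum x, one_mul] at h
    rw [h]
    simp_rw [RandProtocol.bobOut_expect _ (hg0 _)]
    -- `Σ_v w_v(x) g_v(y) = Σ_k Â(x,k) B̂(k,y) = M(x,y)`
    rw [← hAB x y]
    simp only [hw]
    simp_rw [Finset.sum_mul]
    rw [Finset.sum_comm]
    refine Finset.sum_congr rfl fun k _ => ?_
    rw [Finset.sum_eq_single (cd k)]
    · rw [if_pos rfl, hgcode]
    · intro v _ hv
      rw [if_neg (Ne.symm hv), zero_mul]
    · intro h; exact absurd (mem_univ _) h

/-! ### Extended formulations from protocols -/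

open Literature.Barriers.PneNP in
/-- **Faenza–Fiorini–Grappe–Tiwary: randomized protocols for the slack matrix give extended
formulations.** Let `P = conv(v_b : b ∈ B)` with a complete inequality description
`(c_a · x ≤ d_a)_{a ∈ A}`. If a well-formed randomized protocol of complexity `c` (Alice holding the
constraint `a`, Bob the vertex `b`) computes the slack `d_a − c_a · v_b` in expectation, then `P` has an
extended formulation of size `2^c`. [cite: FaenzaFioriniGrappeTiwary2015, Thm. 2 with Thm. 1
(Yannakakis' factorization theorem) and §6 ("every extension of a polytope `P` corresponds to a
randomized protocol computing its slack matrix `S(P)` in expectation and vice-versa")] -/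
theorem FaenzaFioriniGrappeTiwary2015_ef_of_protocol {ι A B : Type} [Fintype ι] [Fintype B]
    (v : B → ι → ℝ) (c : A → ι → ℝ) (d : A → ℝ)
    (hcomplete : ∀ x : ι → ℝ, (∀ a, c a ⬝ᵥ x ≤ d a) → x ∈ convexHull ℝ (Set.range v))
    (P : RandProtocol A B) (hP : P.WF) (hslack : ∀ a b, P.expect a b = d a - c a ⬝ᵥ v b) :
    HasEFOfSize (convexHull ℝ (Set.range v)) (2 ^ P.depth) := by
  obtain ⟨U, W, hU, hW, hfac⟩ :=
    FaenzaFioriniGrappeTiwary2015_thm2 P hP (fun a b => d a - c a ⬝ᵥ v b) hslack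
  have h := hasEFOfSize_of_complete_nonneg_factorization v c d hcomplete U (fun b i => W i b) hU
    (fun b i => hW i b) (fun a b => hfac a b)
  simpa using h


/-! ### Deterministic protocols as randomized protocols; Lemma 3 -/

namespace DetProtocol

variable {X Y β : Type*}

/-- A deterministic protocol tree, its outputs read through `val : β → ℝ`, as a randomized protocol
with `0/1` transition probabilities ("to each node `v` of type `X` is attached a function
`p_v : X → {0,1}`"; bit `0` = left child). [cite: FaenzaFioriniGrappeTiwary2015, §3.1] -/
def toRand (val : β → ℝ) : DetProtocol X Y β → RandProtocol X Y
  | leaf c => RandProtocol.leaf (val c)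
  | alice f P Q => RandProtocol.alice (fun x => if f x then 0 else 1) (toRand val P) (toRand val Q)
  | bob g P Q => RandProtocol.bob (fun y => if g y then 0 else 1) (toRand val P) (toRand val Q)

/-- The embedded protocol computes `val ∘ run` (exactly, hence in expectation).
[cite: FaenzaFioriniGrappeTiwary2015, §3.1] -/
theorem toRand_expect (val : β → ℝ) :
    ∀ (P : DetProtocol X Y β) (x : X) (y : Y), (P.toRand val).expect x y = val (P.run x y)
  | leaf _, _, _ => rfl
  | alice f P Q, x, y => by
      simp only [toRand, RandProtocol.expect, run, toRand_expect val P, toRand_expect val Q]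
      cases f x <;> simp
  | bob g P Q, x, y => by
      simp only [toRand, RandProtocol.expect, run, toRand_expect val P, toRand_expect val Q]
      cases g y <;> simp

/-- The embedding preserves the height. [cite: FaenzaFioriniGrappeTiwary2015, §3.1] -/
theorem toRand_depth (val : β → ℝ) : ∀ P : DetProtocol X Y β, (P.toRand val).depth = P.depth
  | leaf _ => rfl
  | alice _ P Q => by simp only [toRand, RandProtocol.depth, depth, toRand_depth val P, toRand_depth val Q]
  | bob _ P Q => by simp only [toRand, RandProtocol.depth, depth, toRand_depth val P, toRand_depth val Q]

/-- The embedding is well formed when the values are nonnegative. [cite: FaenzaFioriniGrappeTiwary2015, §3.1] -/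
theorem toRand_WF (val : β → ℝ) (hval : ∀ c, 0 ≤ val c) :
    ∀ P : DetProtocol X Y β, (P.toRand val).WF
  | leaf c => hval c
  | alice f P Q => ⟨fun x => by rcases Bool.eq_false_or_eq_true (f x) with h | h <;> simp [h],
      toRand_WF val hval P, toRand_WF val hval Q⟩
  | bob g P Q => ⟨fun y => by rcases Bool.eq_false_or_eq_true (g y) with h | h <;> simp [h],
      toRand_WF val hval P, toRand_WF val hval Q⟩

end DetProtocol

namespace RandProtocol

variable {X Y : Type*}

/-- Alice announces which part of a row partition her input lies in, then the corresponding protocol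
runs. [cite: FaenzaFioriniGrappeTiwary2015, Lemma 3 (proof: "she sends a bit to Bob to indicate
whether her row lies in `R_1` or `R_2`")] -/
def rowSplit (R₁ : X → Bool) (P₁ P₂ : RandProtocol X Y) : RandProtocol X Y :=
  alice (fun x => if R₁ x then 1 else 0) P₁ P₂

/-- `rowSplit` runs `P₁` on `R₁` and `P₂` off `R₁`. [cite: FaenzaFioriniGrappeTiwary2015, Lemma 3 (proof)] -/
theorem rowSplit_expect (R₁ : X → Bool) (P₁ P₂ : RandProtocol X Y) (x : X) (y : Y) :
    (rowSplit R₁ P₁ P₂).expect x y = if R₁ x then P₁.expect x y else P₂.expect x y := by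
  simp only [rowSplit, expect]
  cases R₁ x <;> simp

end RandProtocol

/-- **Faenza–Fiorini–Grappe–Tiwary, Lemma 3.** If the rows of `M` are partitioned into `R₁`, `R₂`
and well-formed randomized protocols of complexity `c₁`, `c₂` compute the two submatrices in
expectation, then a well-formed protocol of complexity `1 + max{c₁, c₂}` computes `M` in expectation.
[cite: FaenzaFioriniGrappeTiwary2015, Lemma 3] -/
theorem FaenzaFioriniGrappeTiwary2015_lemma3 {X Y : Type*} (M : X → Y → ℝ) (R₁ : X → Bool)
    (P₁ P₂ : RandProtocol X Y) (h₁ : P₁.WF) (h₂ : P₂.WF)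
    (hM₁ : ∀ x y, R₁ x = true → P₁.expect x y = M x y)
    (hM₂ : ∀ x y, R₁ x = false → P₂.expect x y = M x y) :
    (RandProtocol.rowSplit R₁ P₁ P₂).WF ∧
      (RandProtocol.rowSplit R₁ P₁ P₂).depth = max P₁.depth P₂.depth + 1 ∧
      ∀ x y, (RandProtocol.rowSplit R₁ P₁ P₂).expect x y = M x y := by
  refine ⟨⟨fun x => by rcases Bool.eq_false_or_eq_true (R₁ x) with h | h <;> simp [h], h₁, h₂⟩, rfl,
    fun x y => ?_⟩
  rw [RandProtocol.rowSplit_expect]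
  cases h : R₁ x
  · simpa using hM₂ x y h
  · simpa using hM₁ x y h

end Literature.Computability.Complexity
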